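import Summits.HodgeConjecture.HodgeConjecture.Theorems.K2E3RankOneEllipticFixedPointCountRamified   -- ★ p855776 (this seat): the `K₂`- and `K♯`-column ℕ-laws at a √π-type ramified place
import HarnessLib

/-!
# K2 ∕ E3 «EllipticInputs», line (ii′) — `K2E3RankOneEllipticFixedSubtreeEulerCharOne`: «χ(Fix γ₂) = 1» read on the tree at a TAME (√π-type) ramified place for the
# torus-form elliptic `γ₂ ∈ U(Φ₂)(L⁺_v)`: `#Fix_{γ₂}(U₂ ⧸ K♯) = #Fix_{γ₂}(U₂ ⧸ K₂) + 1` (vertices = edges + 1 of the fixed subtree), both eigen-order shapes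

Cell `hodgecm-mathlib` (Track B «K2-LIT»), engine E3, crux H413 = `stmt-HodgeConjecture-24833`; dealt BY NAME by the line lead (ii′) K2E4-p06 (g2) 2026-09-03T23:59:02Z (5) to
K2E5-p11 (g2) for the all-`w` Euler–Poincaré payer of K2E4-p21 ∕ K2E4-p08.  PROOF lane, THEOREMS ONLY; `--supports stmt-HodgeConjecture-24833 --as helper` (count-neutral).

★ CENSUS AND SCOPE (report-first 2026-09-04T00:00Z).  The «χ = 1» clauses for EVERY regular elliptic `γ` are already ★ and are NOT restated here: unramified non-split `v`
(`2 ∈ 𝒪_wˣ`) ★ `Rogawski1990.RankOneEulerPoincareNonsplitUnramifiedOdd.epEllipticRelation_of_isUnit_two` (`#Fix(U₂⧸K) + #Fix(U₂⧸K′) = #Fix(U₂⧸I) + 1` at the concrete levels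
`K = cmLocalIntegralLevel`, `K′ = K.map e_d`, `I = K ⊓ K′`); tame ramified `v` ★ `UnitaryTwoEulerPoincareEllipticRamified.natCard_fixedBy_add_eq_natCard_fixedBy_add_one_of_isRegularElt_of_ramified`
(the THREE-TERM relation on the barycentric tree).  The TWO-TERM form `#Fix(U₂⧸K♯) = #Fix(U₂⧸K₂) + 1` is FALSE for an elliptic regular `γ₂ ∈ K₂` that is residually antidiagonal
(it flips the self-dual edge: `1, 0, 0` fixed `K₂`-, `K♯`-, `I`-cosets); it holds for non-inverting `γ₂` — ★ `natCard_fixedBy_add_one_eq_natCard_fixedBy_of_deep_of_ramified` (deep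
`γ₂`), ★ `SLTwoTreeFixedSubtreeCount` §3 (descent fixing a vertex) — and, THIS FILE, for every `γ₂` whose projective descent `g ∈ GL₂(L⁺_v)` is conjugate up to a scalar to a UNIT
`γ₁ = (a, b v_τ; b, a + b u_τ)` (`|b| = |ϖF|ⁿ`) of an INERT resp. EISENSTEIN quadratic order: cancel `q − 1` between the ★ p855776 laws `(q − 1)·#Fix(U₂⧸K♯) + 2 = R` and
`(q − 1)·(#Fix(U₂⧸K₂) + 1) + 2 = R` (`R = (q+1)qⁿ` resp. `2q^{n+1}`).  Binders VERBATIM as in ★ p855776 §3.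
HONEST LABEL: HC_CM is proved only modulo the 7 printed citations (2 remaining named inputs: hLiu418 = stmt-HodgeConjecture-24832, h413 = stmt-HodgeConjecture-24833) until rung 0
closes; count-neutral helper.

## References
* [Kottwitz1988] R. E. Kottwitz, *Tamagawa numbers*, Ann. of Math. 127 (1988), §2 Theorem 2 (`O_γ(f_EP) = χ(X^γ) = 1`; the fixed subtree of an elliptic element).
* [Serre1980Trees] J.-P. Serre, *Trees* (1980), Ch. I §6.1 (fixed points, inversions), Ch. II §1.1–§1.3.
* [Tits1979] J. Tits, *Reductive groups over local fields*, PSPM 33.1 (1979), §3.2 p. 50.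
-/

set_option autoImplicit false
-- the mandated namespace repeats the single-problem summit's segment (`HodgeConjecture.HodgeConjecture`)
set_option linter.dupNamespace false

noncomputable section

namespace Summit.HodgeConjecture.HodgeConjecture.Cruxes.H413.K2E3RankOneEllipticFixedSubtreeEulerCharOne

open MeasureTheory NumberField IsDedekindDomain Matrix MulAction ValuativeRel
open Literature.NumberTheory.Automorphic Literature.NumberTheory.Automorphic.UnitaryGroup Literature.NumberTheory.Automorphic.IntegralReduction
open Literature.NumberTheory.Automorphic.HermitianLatticeTree
open Literature.NumberTheory.Rogawski1990 Literature.NumberTheory.GaloisRepresentations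
open Summit.HodgeConjecture.HodgeConjecture.Cruxes.H413
open scoped Matrix MatrixGroups WithZero ValuativeRel

section Place

variable (L : Type) [Field L] [NumberField L] [IsCMField L] (v : HeightOneSpectrum (𝓞 ↥(maximalRealSubfield L)))
  (w : PlacesOver L v) (hw : IsCMField.complexConj L • w.1 = w.1)
  {α : w.1.adicCompletion L} (hα : galAdicCompletionMap (L := L) (IsCMField.complexConj L) hw α = -α) (hα0 : α ≠ 0)
  {ϖF : v.adicCompletion ↥(maximalRealSubfield L)} (hϖF : Valued.v ϖF = WithZero.exp (-1 : ℤ))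
  [Finite (IsLocalRing.ResidueField 𝒪[v.adicCompletion ↥(maximalRealSubfield L)])]

include hw hα hα0 hϖF in
/-- **«χ(Fix γ₂) = 1», INERT DATUM: `#Fix_{γ₂}(U₂ ⧸ K♯) = #Fix_{γ₂}(U₂ ⧸ K₂) + 1`** at a √π-type ramified place for `γ₂` whose descent is a unit of an inert quadratic order (vertex-centred
fixed ball: `(qⁿ(q+1) − 2)∕(q−1)` vertices, one edge fewer) — the two ★ p855776 laws with `q − 1` cancelled. [cite: Kottwitz1988, §2 Theorem 2] [cite: Serre1980Trees, Ch. I §6.1] -/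
theorem natCard_fixedBy_modular_eq_natCard_fixedBy_cmLocalIntegralLevel_add_one_of_inert (he : v.asIdeal.ramificationIdx' w.1.asIdeal ≠ 1) (hvα : Valued.v α = WithZero.exp (-1 : ℤ))
    (ϖ : (w.1.adicCompletion L)ˣ) (hϖ : Valued.v (ϖ : w.1.adicCompletion L) = WithZero.exp (-1 : ℤ))
    (Ksh : Subgroup ((cmDatum L 2 (Matrix.of fun i j : Fin 2 => if i.val + j.val + 1 = 2 then (1 : L) else 0)).Local v)) (hKsh : ∀ g', g' ∈ Ksh ↔ (((localNonsplitEquiv (IsCMField.complexConj L) (Matrix.of fun i j : Fin 2 => if i.val + j.val + 1 = 2 then (1 : L) else 0) (IsCMField.complexConj_ne_one L) w hw) g' : ↥(unitaryGroupOfForm (galAdicCompletionMap (L := L) (IsCMField.complexConj L) hw) (placeForm (Matrix.of fun i j : Fin 2 => if i.val + j.val + 1 = 2 then (1 : L) else 0) w.1))) : GL (Fin 2) (w.1.adicCompletion L)) ∈ (glInt 2 (w.1.adicCompletion L)).map (MulAut.conj (glDiagonal 2 (w.1.adicCompletion L) ![1, ϖ])).toMonoidHom)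
    (γ₂ : ((cmDatum L 2 (Matrix.of fun i j : Fin 2 => if i.val + j.val + 1 = 2 then (1 : L) else 0)).Local v))
    -- the descent representative `g ∈ GL₂(L⁺_v)` of `E₂ γ₂` (★ `exists_descent_of_antiFixed`)
    {s : w.1.adicCompletion L} {g : GL (Fin 2) (v.adicCompletion ↥(maximalRealSubfield L))} (hs : s ≠ 0)
    (hsg : Matrix.diagonal ![1, α] * ((((localNonsplitEquiv (IsCMField.complexConj L) (Matrix.of fun i j : Fin 2 => if i.val + j.val + 1 = 2 then (1 : L) else 0) (IsCMField.complexConj_ne_one L) w hw) γ₂ : ↥(unitaryGroupOfForm (galAdicCompletionMap (L := L) (IsCMField.complexConj L) hw) (placeForm (Matrix.of fun i j : Fin 2 => if i.val + j.val + 1 = 2 then (1 : L) else 0) w.1))) : GL (Fin 2) (w.1.adicCompletion L)) : Matrix (Fin 2) (Fin 2) (w.1.adicCompletion L)) * Matrix.diagonal ![1, α⁻¹] =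
      s • (g : Matrix (Fin 2) (Fin 2) (v.adicCompletion ↥(maximalRealSubfield L))).map (toPlace v w))
    -- the INERT torus datum of `g`: `h g h⁻¹ = c·γ₁`, `γ₁ = (a, b vτ; b, a + b uτ)` a unit of the inert order, `|b| = |ϖ|ⁿ`
    {uτ vτ : v.adicCompletion ↥(maximalRealSubfield L)} (hu : uτ ∈ 𝒪[v.adicCompletion ↥(maximalRealSubfield L)]) (hv : vτ ∈ 𝒪[v.adicCompletion ↥(maximalRealSubfield L)])
    (hanis : ∀ c e : v.adicCompletion ↥(maximalRealSubfield L), c ∈ 𝒪[v.adicCompletion ↥(maximalRealSubfield L)] → e ∈ 𝒪[v.adicCompletion ↥(maximalRealSubfield L)] → valuation (v.adicCompletion ↥(maximalRealSubfield L)) (c ^ 2 + c * e * uτ - e ^ 2 * vτ) < 1 → valuation (v.adicCompletion ↥(maximalRealSubfield L)) c < 1 ∧ valuation (v.adicCompletion ↥(maximalRealSubfield L)) e < 1)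
    {h γ₁ : GL (Fin 2) (v.adicCompletion ↥(maximalRealSubfield L))} {c a b : v.adicCompletion ↥(maximalRealSubfield L)} (hc : c ≠ 0)
    (hconj : ((h * g * h⁻¹ : GL (Fin 2) (v.adicCompletion ↥(maximalRealSubfield L))) : Matrix (Fin 2) (Fin 2) (v.adicCompletion ↥(maximalRealSubfield L))) = c • (γ₁ : Matrix (Fin 2) (Fin 2) (v.adicCompletion ↥(maximalRealSubfield L))))
    (hγ₁ : (γ₁ : Matrix (Fin 2) (Fin 2) (v.adicCompletion ↥(maximalRealSubfield L))) = !![a, b * vτ; b, a + b * uτ]) (ha : a ∈ 𝒪[v.adicCompletion ↥(maximalRealSubfield L)]) (hb : b ∈ 𝒪[v.adicCompletion ↥(maximalRealSubfield L)])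
    (hγ₁det : valuation (v.adicCompletion ↥(maximalRealSubfield L)) (γ₁ : Matrix (Fin 2) (Fin 2) (v.adicCompletion ↥(maximalRealSubfield L))).det = 1) {n : ℕ} (hbn : valuation (v.adicCompletion ↥(maximalRealSubfield L)) b = valuation (v.adicCompletion ↥(maximalRealSubfield L)) ϖF ^ n)
    (v₀ : {M : Submodule 𝒪[v.adicCompletion ↥(maximalRealSubfield L)] (Fin 2 → v.adicCompletion ↥(maximalRealSubfield L)) // IsSpecialLattice (RingHom.id _) ϖF !![(0 : v.adicCompletion ↥(maximalRealSubfield L)), 1; -1, 0] M}) (hv₀ : v₀.1 = latt (1 : Matrix (Fin 2) (Fin 2) (v.adicCompletion ↥(maximalRealSubfield L)))) :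
    Nat.card (fixedBy (((cmDatum L 2 (Matrix.of fun i j : Fin 2 => if i.val + j.val + 1 = 2 then (1 : L) else 0)).Local v) ⧸ Ksh) γ₂) = Nat.card (fixedBy (((cmDatum L 2 (Matrix.of fun i j : Fin 2 => if i.val + j.val + 1 = 2 then (1 : L) else 0)).Local v) ⧸ cmLocalIntegralLevel L 2 (Matrix.of fun i j : Fin 2 => if i.val + j.val + 1 = 2 then (1 : L) else 0) v) γ₂) + 1 := by
  have hq : 2 ≤ Nat.card (IsLocalRing.ResidueField 𝒪[v.adicCompletion ↥(maximalRealSubfield L)]) := K2E3RankOneEllipticFixedPointCountRamified.two_le_natCard_residueField L v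
  have hV := K2E3RankOneEllipticFixedPointCountRamified.pred_card_mul_natCard_fixedBy_modular_add_two_of_inert L v w hw hα hα0 hϖF he hvα ϖ hϖ Ksh hKsh γ₂ hs hsg hu hv hanis hc hconj hγ₁ ha hb hγ₁det hbn v₀ hv₀
  have hE := K2E3RankOneEllipticFixedPointCountRamified.pred_card_mul_natCard_fixedBy_cmLocalIntegralLevel_succ_add_two_of_inert L v w hw hα hα0 hϖF he hvα γ₂ hs hsg hu hv hanis hc hconj hγ₁ ha hb hγ₁det hbn v₀ hv₀
  have h := hV.trans hE.symm
  exact Nat.eq_of_mul_eq_mul_left (by omega) (Nat.add_right_cancel h)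

include hw hα hα0 hϖF in
/-- **«χ(Fix γ₂) = 1», EISENSTEIN DATUM: `#Fix_{γ₂}(U₂ ⧸ K♯) = #Fix_{γ₂}(U₂ ⧸ K₂) + 1`** at a √π-type ramified place for `γ₂` whose descent is a unit of an Eisenstein quadratic order
(edge-centred fixed ball: `2(q^{n+1} − 1)∕(q − 1)` vertices, one edge fewer). [cite: Kottwitz1988, §2 Theorem 2] [cite: Serre1980Trees, Ch. I §6.1] [cite: Tits1979, §3.2 p. 50] -/
theorem natCard_fixedBy_modular_eq_natCard_fixedBy_cmLocalIntegralLevel_add_one_of_eisenstein (he : v.asIdeal.ramificationIdx' w.1.asIdeal ≠ 1) (hvα : Valued.v α = WithZero.exp (-1 : ℤ))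
    (ϖ : (w.1.adicCompletion L)ˣ) (hϖ : Valued.v (ϖ : w.1.adicCompletion L) = WithZero.exp (-1 : ℤ))
    (Ksh : Subgroup ((cmDatum L 2 (Matrix.of fun i j : Fin 2 => if i.val + j.val + 1 = 2 then (1 : L) else 0)).Local v)) (hKsh : ∀ g', g' ∈ Ksh ↔ (((localNonsplitEquiv (IsCMField.complexConj L) (Matrix.of fun i j : Fin 2 => if i.val + j.val + 1 = 2 then (1 : L) else 0) (IsCMField.complexConj_ne_one L) w hw) g' : ↥(unitaryGroupOfForm (galAdicCompletionMap (L := L) (IsCMField.complexConj L) hw) (placeForm (Matrix.of fun i j : Fin 2 => if i.val + j.val + 1 = 2 then (1 : L) else 0) w.1))) : GL (Fin 2) (w.1.adicCompletion L)) ∈ (glInt 2 (w.1.adicCompletion L)).map (MulAut.conj (glDiagonal 2 (w.1.adicCompletion L) ![1, ϖ])).toMonoidHom)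
    (γ₂ : ((cmDatum L 2 (Matrix.of fun i j : Fin 2 => if i.val + j.val + 1 = 2 then (1 : L) else 0)).Local v))
    -- the descent representative `g ∈ GL₂(L⁺_v)` of `E₂ γ₂` (★ `exists_descent_of_antiFixed`)
    {s : w.1.adicCompletion L} {g : GL (Fin 2) (v.adicCompletion ↥(maximalRealSubfield L))} (hs : s ≠ 0)
    (hsg : Matrix.diagonal ![1, α] * ((((localNonsplitEquiv (IsCMField.complexConj L) (Matrix.of fun i j : Fin 2 => if i.val + j.val + 1 = 2 then (1 : L) else 0) (IsCMField.complexConj_ne_one L) w hw) γ₂ : ↥(unitaryGroupOfForm (galAdicCompletionMap (L := L) (IsCMField.complexConj L) hw) (placeForm (Matrix.of fun i j : Fin 2 => if i.val + j.val + 1 = 2 then (1 : L) else 0) w.1))) : GL (Fin 2) (w.1.adicCompletion L)) : Matrix (Fin 2) (Fin 2) (w.1.adicCompletion L)) * Matrix.diagonal ![1, α⁻¹] =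
      s • (g : Matrix (Fin 2) (Fin 2) (v.adicCompletion ↥(maximalRealSubfield L))).map (toPlace v w))
    -- the EISENSTEIN torus datum of `g`: `|uτ| < 1`, `|vτ| = |ϖ|`; `h g h⁻¹ = c·γ₁`, `γ₁ = (a, b vτ; b, a + b uτ)` a unit of the Eisenstein order, `|b| = |ϖ|ⁿ`
    {uτ vτ : v.adicCompletion ↥(maximalRealSubfield L)} (hu : uτ ∈ 𝒪[v.adicCompletion ↥(maximalRealSubfield L)]) (hu1 : valuation (v.adicCompletion ↥(maximalRealSubfield L)) uτ < 1) (hv1 : valuation (v.adicCompletion ↥(maximalRealSubfield L)) vτ = valuation (v.adicCompletion ↥(maximalRealSubfield L)) ϖF)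
    {h γ₁ : GL (Fin 2) (v.adicCompletion ↥(maximalRealSubfield L))} {c a b : v.adicCompletion ↥(maximalRealSubfield L)} (hc : c ≠ 0)
    (hconj : ((h * g * h⁻¹ : GL (Fin 2) (v.adicCompletion ↥(maximalRealSubfield L))) : Matrix (Fin 2) (Fin 2) (v.adicCompletion ↥(maximalRealSubfield L))) = c • (γ₁ : Matrix (Fin 2) (Fin 2) (v.adicCompletion ↥(maximalRealSubfield L))))
    (hγ₁ : (γ₁ : Matrix (Fin 2) (Fin 2) (v.adicCompletion ↥(maximalRealSubfield L))) = !![a, b * vτ; b, a + b * uτ]) (ha : a ∈ 𝒪[v.adicCompletion ↥(maximalRealSubfield L)]) (hb : b ∈ 𝒪[v.adicCompletion ↥(maximalRealSubfield L)])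
    (hγ₁det : valuation (v.adicCompletion ↥(maximalRealSubfield L)) (γ₁ : Matrix (Fin 2) (Fin 2) (v.adicCompletion ↥(maximalRealSubfield L))).det = 1) {n : ℕ} (hbn : valuation (v.adicCompletion ↥(maximalRealSubfield L)) b = valuation (v.adicCompletion ↥(maximalRealSubfield L)) ϖF ^ n)
    (v₀ : {M : Submodule 𝒪[v.adicCompletion ↥(maximalRealSubfield L)] (Fin 2 → v.adicCompletion ↥(maximalRealSubfield L)) // IsSpecialLattice (RingHom.id _) ϖF !![(0 : v.adicCompletion ↥(maximalRealSubfield L)), 1; -1, 0] M}) (hv₀ : v₀.1 = latt (1 : Matrix (Fin 2) (Fin 2) (v.adicCompletion ↥(maximalRealSubfield L)))) :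
    Nat.card (fixedBy (((cmDatum L 2 (Matrix.of fun i j : Fin 2 => if i.val + j.val + 1 = 2 then (1 : L) else 0)).Local v) ⧸ Ksh) γ₂) = Nat.card (fixedBy (((cmDatum L 2 (Matrix.of fun i j : Fin 2 => if i.val + j.val + 1 = 2 then (1 : L) else 0)).Local v) ⧸ cmLocalIntegralLevel L 2 (Matrix.of fun i j : Fin 2 => if i.val + j.val + 1 = 2 then (1 : L) else 0) v) γ₂) + 1 := by
  have hq : 2 ≤ Nat.card (IsLocalRing.ResidueField 𝒪[v.adicCompletion ↥(maximalRealSubfield L)]) := K2E3RankOneEllipticFixedPointCountRamified.two_le_natCard_residueField L v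
  have hV := K2E3RankOneEllipticFixedPointCountRamified.pred_card_mul_natCard_fixedBy_modular_add_two_of_eisenstein L v w hw hα hα0 hϖF he hvα ϖ hϖ Ksh hKsh γ₂ hs hsg hu hu1 hv1 hc hconj hγ₁ ha hb hγ₁det hbn v₀ hv₀
  have hE := K2E3RankOneEllipticFixedPointCountRamified.pred_card_mul_natCard_fixedBy_cmLocalIntegralLevel_succ_add_two_of_eisenstein L v w hw hα hα0 hϖF he hvα γ₂ hs hsg hu hu1 hv1 hc hconj hγ₁ ha hb hγ₁det hbn v₀ hv₀
  have h := hV.trans hE.symm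
  exact Nat.eq_of_mul_eq_mul_left (by omega) (Nat.add_right_cancel h)

end Place

end Summit.HodgeConjecture.HodgeConjecture.Cruxes.H413.K2E3RankOneEllipticFixedSubtreeEulerCharOne

end
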